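import Summits.Schanuel.Schanuel.Theorems.ZilberEacBranchPoleFibreGrowth
import HarnessLib

/-!
# Arbitrary base branches, XXXV: pole / zero fibre values in the RESIDUE CLASS — the logarithmic
# term `−(ML/k²)·Φ(0)z^{M−k}·n^{M/k−1} log n` of `Re x₁` gives density whenever `M > k`

HONEST FRAMING.  Cell `pub-schanuel` (Zilber's Exponential-Algebraic Closedness, case ladder;
host summit Schanuel), seat 2, gen 29.  File XXXII decided pole/zero fibre values
`y₀ = ψ(s)s^L` along a base branch `x₀ = s^{-k}`, `x₁ = Φ(s)s^{-M}` in a good direction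
`Re(Φ(0)z^M) ≠ 0`.  In a bad direction (`Re(Φ(0)z^M) = 0`, the residue class) the exponential points
of file XXXI, `x₀ = 2πin·q`, `q = 1 + (−(L/k)log n + w_n)/(2πin)`, give
`x₁ = z^M n^{M/k}Φ(s)q^{M/k}` with `q^{M/k} = 1 + (M/k)(q − 1) + O(|q−1|²)`, and
`Re(z^MΦ(0)(q − 1)) = Φ(0)z^{M−k}·(−(L/k)log n + Re w_n)/n` with `Φ(0)z^{M−k} = Φ(0)z^M/(2πi)`
REAL: so `n·Re(x₁/n^{M/k}) = −(ML/k²)Φ(0)z^{M−k}·log n + O(1)` provided the Puiseux tail of `Φ` does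
not interfere — here under the hypothesis `‖Φ(s) − Φ(0)‖ = O(‖s‖^k)` (no Puiseux terms below the
ramification order; satisfied by every sheet of `x₁^k = P(x₀)`).  Hence
**`unprojectedDense_branch_poleFibre_logTerm`**: `L ≠ 0`, `k < M`, `‖Φ − Φ(0)‖ = O(‖s‖^k)`,
bad direction ⟹ dense (growth `|Re x₁| ≍ n^{M/k−1} log n` against `log ‖x₁‖ ≍ log n`); the next
file removes the direction hypothesis (good direction: file XXXII; bad: this file).  For `M = k`
the logarithmic term is of order `log n` only and THEOREM G does not apply (e.g. the conic
`x₁² = x₀² + 1` with `y₀ = x₁`, asymptotic to the rational lines `x₁ = ±x₀`): OPEN.  Decided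
instances of an OPEN question (Mantova–Masser, PLMS 2024 §1 p. 5); EC(3,2) OPEN; NOT Schanuel.
-/

noncomputable section

open Filter Topology Metric Complex
open Literature.NumberTheory.Transcendental Literature.ModelTheory.Zilber
open Literature.ModelTheory.ExponentialFields

set_option linter.dupNamespace false

namespace Summit.Schanuel.Schanuel.Theorems

/-! ## The logarithmic term -/

/-- **Pole / zero fibres in a bad direction: the logarithmic term.**  A cylinder germ
`(s^{-k}, Φ(s)s^{-M}, ψ(s)s^L, e^{x₁})` (`1 ≤ k < M`, `L ≠ 0`, `ψ(0) ≠ 0`, `Φ(0) ≠ 0`,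
`‖Φ(s) − Φ(0)‖ ≤ K‖s‖^k` near `0`) in an irreducible closed `S` of dimension `≤ 2`, with a `k`-th
root `z` of `2πi` such that `Re(Φ(0)z^M) = 0`, has Zariski-dense exponential points:
`|Re x₁| ≍ n^{M/k−1} log n`. [cite: MantovaMasser2023, §1 Further remarks, p. 5 (the question, open
in general)] (new) -/
theorem unprojectedDense_branch_poleFibre_logTerm {S : Set (Fin 2 ⊕ Fin 2 → ℂ)}
    (hS : IsIrreducibleClosed ℂ S) (hdim : zariskiDim ℂ S ≤ (2 : ℕ))
    {k M : ℕ} (hk : 1 ≤ k) (hkM : k < M) {L : ℤ} (hL : L ≠ 0) {ψ : ℂ → ℂ} (hψ : AnalyticAt ℂ ψ 0)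
    (hψ0 : ψ 0 ≠ 0) {Φ : ℂ → ℂ} (hΦ : AnalyticAt ℂ Φ 0) (hΦ0 : Φ 0 ≠ 0)
    (hΦk : ∃ K : ℝ, ∀ᶠ s in 𝓝 (0 : ℂ), ‖Φ s - Φ 0‖ ≤ K * ‖s‖ ^ k)
    {z : ℂ} (hz : z ^ k = 2 * Real.pi * I) (hzre : (Φ 0 * z ^ M).re = 0)
    (hgerm : ∀ᶠ s in 𝓝[≠] (0 : ℂ),
      (Sum.elim ![(s ^ k)⁻¹, Φ s * (s ^ M)⁻¹] ![ψ s * s ^ L, Complex.exp (Φ s * (s ^ M)⁻¹)] :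
        Fin 2 ⊕ Fin 2 → ℂ) ∈ S) :
    UnprojectedDense S := by
  classical
  have hk0 : k ≠ 0 := by omega
  have hkC : (k : ℂ) ≠ 0 := Nat.cast_ne_zero.2 hk0
  have hkR : (0 : ℝ) < k := by exact_mod_cast Nat.pos_of_ne_zero hk0
  have h2πI : (2 * Real.pi * I : ℂ) ≠ 0 := by simp [Real.pi_ne_zero, Complex.I_ne_zero]
  have hz0 : z ≠ 0 := by
    rintro rfl
    rw [zero_pow hk0] at hz
    exact h2πI hz.symm
  obtain ⟨N₀, u, s, w, W, hN₀, hu, hu0, hwW, huq, hsu, hs0, hs, hexp⟩ :=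
    exists_poleFibre_expPoints hk L hψ hψ0 hz
  have hsW : Tendsto s atTop (𝓝[≠] (0 : ℂ)) :=
    tendsto_nhdsWithin_iff.2 ⟨hs, Eventually.of_forall hs0⟩
  obtain ⟨K, hK⟩ := hΦk
  obtain ⟨J₀, hJ₀⟩ := Filter.eventually_atTop.1
    ((hsW.eventually hgerm).and (hs.eventually hK))
  set n : ℕ → ℕ := fun m => N₀ + (J₀ + m) with hn
  have hn1 : ∀ m, 1 ≤ n m := fun m => by simp only [hn]; omega
  set p : ℕ → Fin 2 ⊕ Fin 2 → ℂ := fun m =>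
    Sum.elim ![(s (J₀ + m) ^ k)⁻¹, Φ (s (J₀ + m)) * (s (J₀ + m) ^ M)⁻¹]
      ![ψ (s (J₀ + m)) * s (J₀ + m) ^ L, Complex.exp (Φ (s (J₀ + m)) * (s (J₀ + m) ^ M)⁻¹)]
    with hp
  have hpS : ∀ m, p m ∈ S := fun m => (hJ₀ (J₀ + m) (Nat.le_add_right _ _)).1
  have hΦK : ∀ m, ‖Φ (s (J₀ + m)) - Φ 0‖ ≤ K * ‖s (J₀ + m)‖ ^ k :=
    fun m => (hJ₀ (J₀ + m) (Nat.le_add_right _ _)).2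
  have hpΓ : ∀ m, p m ∈ expGraph ℂ 2 := by
    intro m
    rw [mem_expGraph_iff]
    intro i
    rw [Literature.ModelTheory.ExponentialFields.ExponentialRing.complex_exp_eq]
    fin_cases i
    · simp [hp, hexp (J₀ + m)]
    · simp [hp]
  -- notation: `ℓ = log n`, `a = −L/k`, `ε = (aℓ + w)/(n·2πi)`, `q = 1 + ε`, `Q = e^{(M/k) Log q}`
  set a : ℂ := -(L : ℂ) / k with ha
  set ℓ : ℕ → ℝ := fun m => Real.log (n m : ℝ) with hℓ
  set ε : ℕ → ℂ := fun m => (a * (ℓ m : ℂ) + w (J₀ + m)) / ((n m : ℂ) * (2 * Real.pi * I)) with hε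
  set Q : ℕ → ℂ := fun m => Complex.exp ((M : ℂ) / k * Complex.log (1 + ε m)) with hQ
  have huQ : ∀ m, (u (J₀ + m) ^ M)⁻¹ = Q m := by
    intro m
    rw [huq (J₀ + m), ← Complex.exp_nat_mul, ← Complex.exp_neg]
    simp only [hQ, hε, hℓ, hn]
    congr 1
    field_simp
  have hℓt : Tendsto ℓ atTop atTop := by
    rw [hℓ]
    refine Real.tendsto_log_atTop.comp (tendsto_natCast_atTop_atTop.comp ?_)
    exact (tendsto_add_atTop_nat (N₀ + J₀)).congr fun m => by simp only [hn]; omega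
  set V : ℕ → ℂ := fun m => z ^ M * Φ (s (J₀ + m)) * Q m with hV
  have hx : ∀ m, p m (Sum.inl 1) = (Real.exp ((M : ℝ) / k * ℓ m) : ℂ) * V m := by
    intro m
    simp only [hp, hV, hℓ, Sum.elim_inl, Matrix.cons_val_one, Matrix.cons_val_zero]
    rw [hsu (J₀ + m), ← huQ m]
    have hE : (Complex.exp (-(Real.log ((N₀ + (J₀ + m) : ℕ) : ℝ) : ℂ) / k) ^ M)⁻¹ =
        (Real.exp ((M : ℝ) / k * Real.log ((n m : ℕ) : ℝ)) : ℂ) := by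
      rw [← Complex.exp_nat_mul, ← Complex.exp_neg, Complex.ofReal_exp, hn]
      congr 1
      push_cast
      field_simp
    rw [mul_pow, mul_pow, mul_inv, mul_inv, inv_pow, inv_inv, hE]
    ring
  -- sizes: `ε → 0`, `|ε| ≤ (|a|ℓ + W)/(2πn)`, `n‖s‖^k ≤ 2‖z‖^{-k}` eventually, `Q → 1`
  have hεbd : ∀ m, ‖ε m‖ ≤ (‖a‖ * ℓ m + W) / (2 * Real.pi * n m) := by
    intro m
    have hnpos : (0 : ℝ) < n m := by exact_mod_cast hn1 m
    have hℓ0 : 0 ≤ ℓ m := Real.log_nonneg (by exact_mod_cast hn1 m)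
    have hden : ‖(n m : ℂ) * (2 * Real.pi * I)‖ = 2 * Real.pi * n m := by
      rw [norm_mul, Complex.norm_natCast]
      simp [abs_of_pos Real.pi_pos]
      ring
    rw [hε]
    simp only [norm_div, hden]
    refine div_le_div_of_nonneg_right ?_ (by positivity)
    calc ‖a * (ℓ m : ℂ) + w (J₀ + m)‖ ≤ ‖a * (ℓ m : ℂ)‖ + ‖w (J₀ + m)‖ := norm_add_le _ _
      _ ≤ ‖a‖ * ℓ m + W := by
          rw [norm_mul, Complex.norm_real, Real.norm_eq_abs, abs_of_nonneg hℓ0]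
          linarith [hwW (J₀ + m)]
  have hnt : Tendsto n atTop atTop :=
    (tendsto_add_atTop_nat (N₀ + J₀)).congr fun m => by simp only [hn]; omega
  have hεt : Tendsto ε atTop (𝓝 0) := by
    rw [tendsto_zero_iff_norm_tendsto_zero]
    exact squeeze_zero (fun m => norm_nonneg _) hεbd ((tendsto_log_label_div ‖a‖ W).comp hnt)
  have hut : Tendsto (fun m => u (J₀ + m)) atTop (𝓝 1) :=
    hu.comp ((tendsto_add_atTop_nat J₀).congr fun m => by ring)
  have hst : Tendsto (fun m => s (J₀ + m)) atTop (𝓝 0) :=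
    hs.comp ((tendsto_add_atTop_nat J₀).congr fun m => by ring)
  have hQt : Tendsto Q atTop (𝓝 1) := by
    have h := (hut.pow M).inv₀ (by simp)
    rw [one_pow, inv_one] at h
    exact h.congr fun m => huQ m
  -- Taylor bound for `G(ε) = e^{(M/k) Log(1+ε)}`: `G(0) = 1`, `G′(0) = M/k`
  set G : ℂ → ℂ := fun e => Complex.exp ((M : ℂ) / k * Complex.log (1 + e)) with hG
  have hGan : AnalyticAt ℂ G 0 := by
    have h1 : AnalyticAt ℂ (fun e : ℂ => 1 + e) 0 := analyticAt_const.add analyticAt_id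
    exact (analyticAt_const.mul (h1.clog (by simp [Complex.one_mem_slitPlane]))).cexp
  have hG0 : G 0 = 1 := by simp [hG]
  have hGd : deriv G 0 = (M : ℂ) / k := by
    have h1 : HasDerivAt (fun e : ℂ => 1 + e) 1 0 := (hasDerivAt_id (0 : ℂ)).const_add 1
    have h2 : HasDerivAt (fun e : ℂ => Complex.log (1 + e)) ((1 + 0 : ℂ)⁻¹ * 1) 0 :=
      (Complex.hasDerivAt_log (by simp [Complex.one_mem_slitPlane])).comp 0 h1
    have h3 := (h2.const_mul ((M : ℂ) / k)).cexp
    have h4 : HasDerivAt G (Complex.exp ((M : ℂ) / k * Complex.log (1 + 0)) *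
        ((M : ℂ) / k * ((1 + 0 : ℂ)⁻¹ * 1))) 0 := by
      rw [hG]
      exact h3
    rw [h4.deriv]
    simp
  obtain ⟨C, δ, hC0, hδ0, hC⟩ := exists_taylor_two_bound hGan
  rw [hG0, hGd] at hC
  set ρ : ℕ → ℂ := fun m => Q m - 1 - (M : ℂ) / k * ε m with hρ
  have hρbd : ∀ᶠ m in atTop, ‖ρ m‖ ≤ C * ‖ε m‖ ^ 2 := by
    filter_upwards [(tendsto_zero_iff_norm_tendsto_zero.1 hεt).eventually (gt_mem_nhds hδ0)]
      with m hm
    have := hC (ε m) hm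
    simpa only [hρ, hQ, hG] using this
  -- the real constant `R₀ = Φ(0) z^{M−k}` and `C₀`
  set R₀ : ℂ := Φ 0 * z ^ (M - k) with hR₀
  have hzΦ : z ^ M * Φ 0 = R₀ * (2 * Real.pi * I) := by
    rw [hR₀, ← hz, mul_assoc, ← pow_add, Nat.sub_add_cancel hkM.le, mul_comm]
  have hR₀im : R₀.im = 0 := by
    have h : (Φ 0 * z ^ M).re = (R₀ * (2 * Real.pi * I)).re := by rw [← hzΦ, mul_comm]
    rw [hzre] at h
    have h' : (R₀ * (2 * Real.pi * I)).re = -(2 * Real.pi) * R₀.im := by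
      simp [Complex.mul_re]
      ring
    rw [h'] at h
    have h2π : (2 * Real.pi : ℝ) ≠ 0 := by positivity
    have : 2 * Real.pi * R₀.im = 0 := by linarith
    exact (mul_eq_zero.1 this).resolve_left h2π
  set r₀ : ℝ := R₀.re with hr₀
  have hR₀r : R₀ = (r₀ : ℂ) := Complex.ext (by simp [hr₀]) (by simp [hR₀im])
  have hr₀0 : r₀ ≠ 0 := by
    intro h0
    have : R₀ = 0 := by rw [hR₀r, h0, Complex.ofReal_zero]
    rw [hR₀] at this
    exact mul_ne_zero hΦ0 (pow_ne_zero _ hz0) this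
  set aR : ℝ := -(L : ℝ) / k with haR
  have haR' : a = (aR : ℂ) := by rw [ha, haR]; push_cast; ring
  have haR0 : aR ≠ 0 := by
    rw [haR]
    exact div_ne_zero (neg_ne_zero.2 (Int.cast_ne_zero.2 hL)) hkR.ne'
  have hMR : (0 : ℝ) < M := by exact_mod_cast (show 0 < M by omega)
  set C₀ : ℝ := (M : ℝ) / k * r₀ * aR with hC₀
  clear_value C₀
  have hC₀0 : C₀ ≠ 0 := by
    rw [hC₀]
    exact mul_ne_zero (mul_ne_zero (div_ne_zero hMR.ne' hkR.ne') hr₀0) haR0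
  -- the key algebraic identity, and its real part
  have key : ∀ m, (n m : ℂ) * (z ^ M * Φ 0) * ε m = (r₀ : ℂ) * (a * (ℓ m : ℂ) + w (J₀ + m)) := by
    intro m
    have hnC : (n m : ℂ) ≠ 0 := Nat.cast_ne_zero.2 (by have := hn1 m; omega)
    rw [hzΦ, hR₀r, hε]
    field_simp
  have hre_id : ∀ m, (n m : ℝ) * (V m).re = C₀ * ℓ m +
      ((M : ℝ) / k * r₀ * (w (J₀ + m)).re + (n m : ℝ) * (z ^ M * Φ 0 * ρ m).re +
        (n m : ℝ) * (z ^ M * (Φ (s (J₀ + m)) - Φ 0) * Q m).re) := by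
    intro m
    have hdec : (n m : ℂ) * V m = (n m : ℂ) * (z ^ M * Φ 0) +
        (M : ℂ) / k * ((n m : ℂ) * (z ^ M * Φ 0) * ε m) + (n m : ℂ) * (z ^ M * Φ 0 * ρ m) +
        (n m : ℂ) * (z ^ M * (Φ (s (J₀ + m)) - Φ 0) * Q m) := by
      simp only [hV, hρ]
      ring
    rw [key m, haR'] at hdec
    have h := congrArg Complex.re hdec
    rw [show ((n m : ℂ) * V m).re = (n m : ℝ) * (V m).re by
      rw [← Complex.ofReal_natCast, Complex.re_ofReal_mul]] at h
    rw [h]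
    simp only [Complex.add_re]
    have e1 : ((n m : ℂ) * (z ^ M * Φ 0)).re = 0 := by
      rw [← Complex.ofReal_natCast, Complex.re_ofReal_mul, mul_comm (z ^ M), hzre, mul_zero]
    have e2 : ((M : ℂ) / k * ((r₀ : ℂ) * ((aR : ℂ) * (ℓ m : ℂ) + w (J₀ + m)))).re =
        (M : ℝ) / k * r₀ * (aR * ℓ m + (w (J₀ + m)).re) := by
      rw [show ((M : ℂ) / k) = (((M : ℝ) / k : ℝ) : ℂ) by push_cast; ring, Complex.re_ofReal_mul,
        Complex.re_ofReal_mul]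
      simp only [Complex.add_re, Complex.re_ofReal_mul, Complex.ofReal_re]
      ring
    have e3 : ((n m : ℂ) * (z ^ M * Φ 0 * ρ m)).re = (n m : ℝ) * (z ^ M * Φ 0 * ρ m).re := by
      rw [← Complex.ofReal_natCast, Complex.re_ofReal_mul]
    have e4 : ((n m : ℂ) * (z ^ M * (Φ (s (J₀ + m)) - Φ 0) * Q m)).re =
        (n m : ℝ) * (z ^ M * (Φ (s (J₀ + m)) - Φ 0) * Q m).re := by
      rw [← Complex.ofReal_natCast, Complex.re_ofReal_mul]
    rw [e1, e2, e3, e4, hC₀]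
    ring
  set K' : ℝ := max K 1 with hK'
  have hK'0 : 0 < K' := lt_of_lt_of_le one_pos (le_max_right _ _)
  have hΦK' : ∀ m, ‖Φ (s (J₀ + m)) - Φ 0‖ ≤ K' * ‖s (J₀ + m)‖ ^ k := fun m =>
    (hΦK m).trans (mul_le_mul_of_nonneg_right (le_max_left _ _) (by positivity))
  have hns : ∀ m, (n m : ℝ) * ‖s (J₀ + m)‖ ^ k = ‖z⁻¹‖ ^ k * ‖u (J₀ + m)‖ ^ k := by
    intro m
    have hnpos : (0 : ℝ) < n m := by exact_mod_cast hn1 m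
    rw [hsu (J₀ + m), norm_mul, norm_mul, mul_pow, mul_pow,
      show (-(Real.log ((N₀ + (J₀ + m) : ℕ) : ℝ) : ℂ) / k) = ((-(Real.log (n m : ℝ)) / k : ℝ) : ℂ) by
        rw [hn]; push_cast; ring,
      ← Complex.ofReal_exp, Complex.norm_real, Real.norm_eq_abs, abs_of_pos (Real.exp_pos _),
      ← Real.exp_nat_mul, show (k : ℝ) * (-(Real.log (n m : ℝ)) / k) = -Real.log (n m : ℝ) by
        field_simp, Real.exp_neg, Real.exp_log hnpos]
    field_simp
  set B : ℝ := (M : ℝ) / k * |r₀| * W + ‖z ^ M * Φ 0‖ * C * 1 + ‖z‖ ^ M * K' * (‖z⁻¹‖ ^ k * 2) * 2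
    with hB
  have hEbd : ∀ᶠ m in atTop, |(n m : ℝ) * (V m).re - C₀ * ℓ m| ≤ B := by
    have hε2 : ∀ᶠ m in atTop, (n m : ℝ) * ‖ε m‖ ^ 2 ≤ 1 := by
      -- `n‖ε‖² ≤ (|a|ℓ + W)²/(4π² n) → 0`
      have h1 : Tendsto (fun m => (‖a‖ * ℓ m + W) ^ 2 / (n m : ℝ)) atTop (𝓝 0) := by
        have hsq : Tendsto (fun x : ℝ => (‖a‖ * Real.log x + W) ^ 2 / x) atTop (𝓝 0) := by
          have hl2 := isLittleO_log_rpow_atTop (by norm_num : (0 : ℝ) < 1 / 2)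
          have hl2' : Tendsto (fun x : ℝ => Real.log x / x ^ (1 / 2 : ℝ)) atTop (𝓝 0) :=
            hl2.tendsto_div_nhds_zero
          have hc : Tendsto (fun x : ℝ => W / x ^ (1 / 2 : ℝ)) atTop (𝓝 0) :=
            tendsto_const_nhds.div_atTop (tendsto_rpow_atTop (by norm_num))
          have h := ((hl2'.const_mul ‖a‖).add hc).pow 2
          rw [mul_zero, zero_add, zero_pow two_ne_zero] at h
          refine h.congr' ?_
          filter_upwards [eventually_gt_atTop 0] with x hx
          have hx2 : (x ^ (1 / 2 : ℝ)) ^ 2 = x := by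
            rw [← Real.rpow_natCast, ← Real.rpow_mul hx.le]; norm_num
          field_simp
          rw [hx2]
          ring
        exact hsq.comp (tendsto_natCast_atTop_atTop.comp hnt)
      filter_upwards [(tendsto_order.1 h1).2 1 one_pos] with m hm
      have hnpos : (0 : ℝ) < n m := by exact_mod_cast hn1 m
      have hℓ0 : 0 ≤ ℓ m := Real.log_nonneg (by exact_mod_cast hn1 m)
      have hW0 : 0 ≤ W := (norm_nonneg _).trans (hwW 0)
      have hD0 : 0 ≤ ‖a‖ * ℓ m + W := by positivity
      have hD : ‖ε m‖ ≤ (‖a‖ * ℓ m + W) / n m := by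
        refine (hεbd m).trans (div_le_div_of_nonneg_left hD0 hnpos ?_)
        have hπ : (1 : ℝ) ≤ 2 * Real.pi := by linarith [Real.pi_gt_three]
        nlinarith
      calc (n m : ℝ) * ‖ε m‖ ^ 2 ≤ (n m : ℝ) * ((‖a‖ * ℓ m + W) / n m) ^ 2 :=
            mul_le_mul_of_nonneg_left (pow_le_pow_left₀ (norm_nonneg _) hD 2) hnpos.le
        _ = (‖a‖ * ℓ m + W) ^ 2 / (n m) := by field_simp
        _ ≤ 1 := hm.le
    have hu2 : ∀ᶠ m in atTop, ‖u (J₀ + m)‖ ^ k ≤ 2 := by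
      have h := ((continuous_norm.tendsto _).comp hut).pow k
      rw [Function.comp_def] at h
      simp only [norm_one, one_pow] at h
      filter_upwards [(tendsto_order.1 h).2 2 (by norm_num)] with m hm
      exact hm.le
    have hQ2 : ∀ᶠ m in atTop, ‖Q m‖ ≤ 2 := by
      have h := (continuous_norm.tendsto _).comp hQt
      rw [Function.comp_def, norm_one] at h
      filter_upwards [(tendsto_order.1 h).2 2 (by norm_num)] with m hm
      exact hm.le
    filter_upwards [hρbd, hε2, hu2, hQ2] with m hρm hε2m hu2m hQ2m
    have hnpos : (0 : ℝ) < n m := by exact_mod_cast hn1 m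
    rw [hre_id m, add_sub_cancel_left]
    have t1 : |(M : ℝ) / k * r₀ * (w (J₀ + m)).re| ≤ (M : ℝ) / k * |r₀| * W := by
      rw [abs_mul, abs_mul, abs_of_nonneg (by positivity : (0 : ℝ) ≤ (M : ℝ) / k)]
      exact mul_le_mul_of_nonneg_left ((Complex.abs_re_le_norm _).trans (hwW _)) (by positivity)
    have t2 : |(n m : ℝ) * (z ^ M * Φ 0 * ρ m).re| ≤ ‖z ^ M * Φ 0‖ * C * 1 := by
      rw [abs_mul, abs_of_pos hnpos]
      calc (n m : ℝ) * |(z ^ M * Φ 0 * ρ m).re| ≤ (n m : ℝ) * (‖z ^ M * Φ 0‖ * ‖ρ m‖) := by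
            refine mul_le_mul_of_nonneg_left ?_ hnpos.le
            exact (Complex.abs_re_le_norm _).trans (by rw [norm_mul])
        _ ≤ (n m : ℝ) * (‖z ^ M * Φ 0‖ * (C * ‖ε m‖ ^ 2)) := by
            exact mul_le_mul_of_nonneg_left (mul_le_mul_of_nonneg_left hρm (norm_nonneg _)) hnpos.le
        _ = ‖z ^ M * Φ 0‖ * C * ((n m : ℝ) * ‖ε m‖ ^ 2) := by ring
        _ ≤ ‖z ^ M * Φ 0‖ * C * 1 := mul_le_mul_of_nonneg_left hε2m (by positivity)
    have t3 : |(n m : ℝ) * (z ^ M * (Φ (s (J₀ + m)) - Φ 0) * Q m).re| ≤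
        ‖z‖ ^ M * K' * (‖z⁻¹‖ ^ k * 2) * 2 := by
      rw [abs_mul, abs_of_pos hnpos]
      calc (n m : ℝ) * |(z ^ M * (Φ (s (J₀ + m)) - Φ 0) * Q m).re|
          ≤ (n m : ℝ) * (‖z‖ ^ M * ‖Φ (s (J₀ + m)) - Φ 0‖ * ‖Q m‖) := by
            refine mul_le_mul_of_nonneg_left ?_ hnpos.le
            exact (Complex.abs_re_le_norm _).trans (by rw [norm_mul, norm_mul, norm_pow])
        _ ≤ (n m : ℝ) * (‖z‖ ^ M * (K' * ‖s (J₀ + m)‖ ^ k) * 2) := by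
            refine mul_le_mul_of_nonneg_left ?_ hnpos.le
            exact mul_le_mul (mul_le_mul_of_nonneg_left (hΦK' m) (by positivity)) hQ2m
              (norm_nonneg _) (by positivity)
        _ = ‖z‖ ^ M * K' * ((n m : ℝ) * ‖s (J₀ + m)‖ ^ k) * 2 := by ring
        _ = ‖z‖ ^ M * K' * (‖z⁻¹‖ ^ k * ‖u (J₀ + m)‖ ^ k) * 2 := by rw [hns m]
        _ ≤ ‖z‖ ^ M * K' * (‖z⁻¹‖ ^ k * 2) * 2 := by
            have : ‖z⁻¹‖ ^ k * ‖u (J₀ + m)‖ ^ k ≤ ‖z⁻¹‖ ^ k * 2 :=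
              mul_le_mul_of_nonneg_left hu2m (by positivity)
            exact mul_le_mul_of_nonneg_right (mul_le_mul_of_nonneg_left this (by positivity))
              (by norm_num)
    rw [hB]
    refine (abs_add_le _ _).trans (add_le_add ((abs_add_le _ _).trans (add_le_add t1 t2)) t3)
  -- lower bound on `|Re x₁|` and upper bound on `‖x₁‖`
  set α : ℝ := (M : ℝ) / k - 1 with hα
  have hα0 : 0 < α := by
    rw [hα, sub_pos, lt_div_iff₀ hkR, one_mul]
    exact_mod_cast hkM
  have hexpℓ : ∀ m, Real.exp (ℓ m) = (n m : ℝ) := fun m =>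
    Real.exp_log (by exact_mod_cast hn1 m)
  have hre : ∀ᶠ m in atTop, |C₀| / 2 * Real.exp (α * ℓ m) ≤ |(p m (Sum.inl 1)).re| := by
    filter_upwards [hEbd, hℓt.eventually (eventually_ge_atTop (max 1 (2 * B / |C₀|)))]
      with m hEm hℓm
    have hnpos : (0 : ℝ) < n m := by exact_mod_cast hn1 m
    have hℓ1 : 1 ≤ ℓ m := le_trans (le_max_left _ _) hℓm
    have hℓB : 2 * B / |C₀| ≤ ℓ m := le_trans (le_max_right _ _) hℓm
    have hC₀pos : 0 < |C₀| := abs_pos.2 hC₀0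
    have h1 : |C₀| * ℓ m - B ≤ (n m : ℝ) * |(V m).re| := by
      have h := abs_sub_abs_le_abs_sub (C₀ * ℓ m) ((n m : ℝ) * (V m).re)
      have e1 : |C₀ * ℓ m| = |C₀| * ℓ m := by
        rw [abs_mul, abs_of_nonneg (by linarith : (0 : ℝ) ≤ ℓ m)]
      have e2 : |(n m : ℝ) * (V m).re| = (n m : ℝ) * |(V m).re| := by
        rw [abs_mul, abs_of_pos hnpos]
      rw [e1, e2, abs_sub_comm] at h
      linarith
    have h2 : |C₀| / 2 * ℓ m ≤ |C₀| * ℓ m - B := by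
      rw [div_le_iff₀ hC₀pos] at hℓB
      linarith
    rw [hx m, Complex.re_ofReal_mul, abs_mul, abs_of_pos (Real.exp_pos _)]
    have h3 : Real.exp ((M : ℝ) / k * ℓ m) = Real.exp (α * ℓ m) * (n m : ℝ) := by
      rw [← hexpℓ m, ← Real.exp_add, hα]
      ring_nf
    rw [h3]
    have h4 : |C₀| / 2 * ℓ m ≤ (n m : ℝ) * |(V m).re| := h2.trans h1
    have hE0 : 0 < Real.exp (α * ℓ m) := Real.exp_pos _
    calc |C₀| / 2 * Real.exp (α * ℓ m) ≤ |C₀| / 2 * ℓ m * Real.exp (α * ℓ m) := by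
          have : |C₀| / 2 * Real.exp (α * ℓ m) * 1 ≤ |C₀| / 2 * Real.exp (α * ℓ m) * ℓ m :=
            mul_le_mul_of_nonneg_left hℓ1 (by positivity)
          linarith
      _ ≤ (n m : ℝ) * |(V m).re| * Real.exp (α * ℓ m) := mul_le_mul_of_nonneg_right h4 hE0.le
      _ = Real.exp (α * ℓ m) * (n m : ℝ) * |(V m).re| := by ring
  have hnorm : ∀ᶠ m in atTop, ‖p m (Sum.inl 1)‖ ≤ Real.exp (((M : ℝ) / k + 1) * ℓ m) := by
    have hQ2 : ∀ᶠ m in atTop, ‖Q m‖ ≤ 2 := by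
      have h := (continuous_norm.tendsto _).comp hQt
      rw [Function.comp_def, norm_one] at h
      filter_upwards [(tendsto_order.1 h).2 2 (by norm_num)] with m hm
      exact hm.le
    have hΦ2 : ∀ᶠ m in atTop, ‖Φ (s (J₀ + m))‖ ≤ ‖Φ 0‖ + 1 := by
      have h := (continuous_norm.tendsto _).comp (hΦ.continuousAt.tendsto.comp hst)
      rw [Function.comp_def] at h
      filter_upwards [(tendsto_order.1 h).2 (‖Φ 0‖ + 1) (by simp)] with m hm
      exact hm.le
    filter_upwards [hQ2, hΦ2, hnt.eventually (eventually_ge_atTop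
      (Nat.ceil (‖z‖ ^ M * (‖Φ 0‖ + 1) * 2)))] with m hQm hΦm hnm
    have hnpos : (0 : ℝ) < n m := by exact_mod_cast hn1 m
    rw [hx m, norm_mul, Complex.norm_real, Real.norm_eq_abs, abs_of_pos (Real.exp_pos _), add_mul,
      one_mul, Real.exp_add, hexpℓ m]
    refine mul_le_mul_of_nonneg_left ?_ (Real.exp_pos _).le
    calc ‖V m‖ ≤ ‖z‖ ^ M * (‖Φ 0‖ + 1) * 2 := by
          rw [hV]
          simp only [norm_mul, norm_pow]
          exact mul_le_mul (mul_le_mul_of_nonneg_left hΦm (by positivity)) hQm (norm_nonneg _)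
            (by positivity)
      _ ≤ (n m : ℝ) := le_trans (Nat.le_ceil _) (by exact_mod_cast hnm)
  have hgr := tendsto_growth_ratio_of_exp_bounds hα0 (by positivity : (0 : ℝ) ≤ (M : ℝ) / k + 1)
    (by positivity : 0 < |C₀| / 2) hℓt hre hnorm
  exact unprojectedDense_of_growth hS hdim 1 hpS hpΓ hgr

end Summit.Schanuel.Schanuel.Theorems

end
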